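import Literature.NumberTheory.Transcendental.KZCubicalCalculus
import Literature.Topology.Euclidean.InvarianceOfDomain
import Literature.Topology.FourManifolds.WhiteheadBendMap
import Summits.KontsevichZagierPeriods.KontsevichZagierPeriods.Theorems.FurushoPentagonReducedPeriodRingLinStokesSymDefs
import Mathlib.Analysis.Convex.PathConnected
import Mathlib.Analysis.Convex.Topology

/-!
# `ReducedPeriodRing`, line `lin-stokes-sym`: self-homeomorphisms of the cube preserve the boundary

Helper file for the stub `stub_hyperoctahedralFactorisation` of crux
`FurushoPentagon.ReducedPeriodRing` (stmt-KontsevichZagierPeriods-3929), line `lin-stokes-sym`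
(registered sub-goal `stub_hyperoctahedral_boundary`). For a continuous injective map `Φ` of the
closed unit cube `C = [0,1]ⁿ` onto itself we prove that `Φ` maps the open cube `U = (0,1)ⁿ`
(`openUnitCube n`) onto `U` and the boundary `∂C = C ∖ U` (file-local notation `∂C[n]`) onto `∂C`
(`Hyperoctahedral.image_openUnitCube`, `Hyperoctahedral.mapsTo_bdry`, `Hyperoctahedral.surjOn_bdry`).

Proof. By Brouwer's invariance of domain
(`Literature.Topology.Euclidean.Brouwer.isOpen_image_of_injOn`) the image `Θ(U)` of the open cube
under ANY continuous injective map `Θ` of `C` into `C` is open in `ℝⁿ`; being contained in `C` it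
is contained in `interior C = U` (`mapsTo_openUnitCube`). Applied to `Φ` this gives `Φ(U) ⊆ U`;
applied to the inverse map `Φ⁻¹ : C → C`, which is continuous because `C` is compact
(`Literature.Topology.FourManifolds.continuousOn_invFunOn_of_isCompact`), it gives `Φ⁻¹(U) ⊆ U`,
i.e. `Φ(∂C) ⊆ ∂C`. Since `Φ` is onto, `Φ(∂C) = ∂C` and `Φ(U) = U`.

References: L. E. J. Brouwer, *Beweis der Invarianz des n-dimensionalen Gebiets*, Math. Ann. 71
(1911), 305–313; T. Tao, *Hilbert's fifth problem and related topics*, AMS GSM 153 (2014),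
Thm. 6.0.12.
-/

noncomputable section

namespace Summit.KontsevichZagierPeriods.FurushoPentagon.ReducedPeriodRing.LinStokesSym

open Set Filter Topology
open Literature.NumberTheory.Transcendental
open Literature.NumberTheory.Transcendental.KZ

namespace Hyperoctahedral

variable {n : ℕ}

/-- The boundary `∂C = {x ∈ [0,1]ⁿ | some xᵢ ∈ {0,1}}` of the closed cube (file-local notation). -/
local notation3 (prettyPrint := false) "∂C[" n "]" =>
  {x : Fin n → ℝ | x ∈ cube n ∧ ∃ i, x i = 0 ∨ x i = 1}

/-! ### The open cube `openUnitCube n = (0,1)ⁿ` and the interior of the closed cube -/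

/-- The interior of the closed cube is the open cube. [folklore] -/
theorem interior_cube (n : ℕ) : interior (cube n) = openUnitCube n := by
  have h : openUnitCube n = Set.pi univ fun _ => Ioo (0 : ℝ) 1 := by
    ext x
    simp [mem_openUnitCube_iff]
  rw [cube_eq_pi, h, interior_pi_set finite_univ]
  simp only [interior_Icc]

/-- The closure of the open cube is the closed cube. [folklore] -/
theorem closure_openUnitCube (n : ℕ) : closure (openUnitCube n) = cube n := by
  have h : openUnitCube n = Set.pi univ fun _ => Ioo (0 : ℝ) 1 := by
    ext x
    simp [mem_openUnitCube_iff]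
  rw [cube_eq_pi, h, closure_pi_set]
  simp only [closure_Ioo zero_ne_one]

/-- The open cube is convex. [folklore] -/
theorem convex_openUnitCube : Convex ℝ (openUnitCube n) := by
  have h : openUnitCube n = Set.pi univ fun _ => Ioo (0 : ℝ) 1 := by
    ext x
    simp [mem_openUnitCube_iff]
  rw [h]
  exact convex_pi fun _ _ => convex_Ioo 0 1

/-- The open cube is preconnected. [folklore] -/
theorem isPreconnected_openUnitCube : IsPreconnected (openUnitCube n) :=
  convex_openUnitCube.isPreconnected

/-- The centre of the cube lies in the open cube. [folklore] -/
theorem center_mem_openUnitCube : (fun _ => (1 / 2 : ℝ)) ∈ openUnitCube n :=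
  fun _ => by norm_num

/-! ### Invariance of domain on the cube -/

/-- **Invariance of domain on the cube.** A continuous injective map of the closed cube into
itself maps the open cube into the open cube: the image of the open cube is open (Brouwer) and
contained in the cube, hence in its interior. (Tao 2014, Thm. 6.0.12.) [folklore] -/
theorem mapsTo_openUnitCube {Θ : (Fin n → ℝ) → (Fin n → ℝ)} (hc : ContinuousOn Θ (cube n))
    (hinj : InjOn Θ (cube n)) (hmaps : MapsTo Θ (cube n) (cube n)) :
    MapsTo Θ (openUnitCube n) (openUnitCube n) := by
  have hopen : IsOpen (Θ '' openUnitCube n) :=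
    Literature.Topology.Euclidean.Brouwer.isOpen_image_of_injOn rfl isOpen_openUnitCube
      (hc.mono openUnitCube_subset_cube) (hinj.mono openUnitCube_subset_cube)
  have hsub : Θ '' openUnitCube n ⊆ interior (cube n) :=
    interior_maximal (image_subset_iff.2 fun x hx => hmaps (openUnitCube_subset_cube hx)) hopen
  rw [interior_cube] at hsub
  exact fun x hx => hsub (mem_image_of_mem Θ hx)

/-! ### The boundary of the cube -/

/-- The boundary lies in the cube. [folklore] -/
theorem bdry_subset_cube : ∂C[n] ⊆ cube n := fun _ hx => hx.1

/-- A boundary point is not in the open cube. [folklore] -/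
theorem not_mem_openUnitCube_of_mem_bdry {x : Fin n → ℝ} (hx : x ∈ ∂C[n]) :
    x ∉ openUnitCube n := by
  obtain ⟨i, hi | hi⟩ := hx.2
  · exact fun h => (h i).1.ne' hi
  · exact fun h => (h i).2.ne hi

/-- A point of the cube outside the open cube is a boundary point. [folklore] -/
theorem mem_bdry_of_not_mem_openUnitCube {x : Fin n → ℝ} (hx : x ∈ cube n)
    (hxo : x ∉ openUnitCube n) : x ∈ ∂C[n] := by
  refine ⟨hx, ?_⟩
  by_contra h
  push Not at h
  exact hxo fun i => ⟨lt_of_le_of_ne (hx i).1 (Ne.symm (h i).1), lt_of_le_of_ne (hx i).2 (h i).2⟩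

/-- The boundary is the cube minus the open cube. [folklore] -/
theorem bdry_eq_diff (n : ℕ) : ∂C[n] = cube n \ openUnitCube n := by
  ext x
  exact ⟨fun hx => ⟨hx.1, not_mem_openUnitCube_of_mem_bdry hx⟩,
    fun hx => mem_bdry_of_not_mem_openUnitCube hx.1 hx.2⟩

/-- The boundary is compact. [folklore] -/
theorem isCompact_bdry : IsCompact (∂C[n]) := by
  rw [bdry_eq_diff]
  exact isCompact_cube.diff isOpen_openUnitCube

/-! ### Self-maps of the cube: interior to interior, boundary onto boundary -/

section SelfMap

variable {Φ : (Fin n → ℝ) → (Fin n → ℝ)}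

/-- An onto self-map of the cube maps the cube into the cube. [folklore] -/
theorem mapsTo_cube (hsurj : Φ '' cube n = cube n) : MapsTo Φ (cube n) (cube n) :=
  fun _ hx => hsurj.subset (mem_image_of_mem Φ hx)

/-- An onto self-map of the cube is onto (as `Set.SurjOn`). [folklore] -/
theorem surjOn_cube (hsurj : Φ '' cube n = cube n) : SurjOn Φ (cube n) (cube n) :=
  fun _ hy => hsurj.symm.subset hy

/-- **Boundary points do not go to interior points.** For a continuous injective map `Φ` of the
cube onto itself, a point of the cube whose image is in the open cube is itself in the open cube:
invariance of domain for the (continuous) inverse map. (Tao 2014, Thm. 6.0.12.) [folklore] -/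
theorem mem_openUnitCube_of_apply_mem (hc : ContinuousOn Φ (cube n)) (hinj : InjOn Φ (cube n))
    (hsurj : Φ '' cube n = cube n) {x : Fin n → ℝ} (hx : x ∈ cube n) (hΦx : Φ x ∈ openUnitCube n) :
    x ∈ openUnitCube n := by
  have hsurj' : SurjOn Φ (cube n) (cube n) := surjOn_cube hsurj
  have hΨc : ContinuousOn (Function.invFunOn Φ (cube n)) (cube n) := by
    have h := Literature.Topology.FourManifolds.continuousOn_invFunOn_of_isCompact isCompact_cube hc hinj
    rwa [hsurj] at h
  have hΨinj : InjOn (Function.invFunOn Φ (cube n)) (cube n) :=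
    Set.LeftInvOn.injOn hsurj'.rightInvOn_invFunOn
  have key := mapsTo_openUnitCube hΨc hΨinj hsurj'.mapsTo_invFunOn hΦx
  rwa [hinj.leftInvOn_invFunOn hx] at key

/-- A continuous injective map of the cube onto itself maps the boundary into the boundary.
(Tao 2014, Thm. 6.0.12.) [folklore] -/
theorem mapsTo_bdry (hc : ContinuousOn Φ (cube n)) (hinj : InjOn Φ (cube n))
    (hsurj : Φ '' cube n = cube n) : MapsTo Φ (∂C[n]) (∂C[n]) := fun _ hx =>
  mem_bdry_of_not_mem_openUnitCube (mapsTo_cube hsurj hx.1) fun h =>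
    not_mem_openUnitCube_of_mem_bdry hx (mem_openUnitCube_of_apply_mem hc hinj hsurj hx.1 h)

/-- A continuous injective map of the cube onto itself maps the boundary onto the boundary.
(Tao 2014, Thm. 6.0.12.) [folklore] -/
theorem surjOn_bdry (hc : ContinuousOn Φ (cube n)) (hinj : InjOn Φ (cube n))
    (hsurj : Φ '' cube n = cube n) : SurjOn Φ (∂C[n]) (∂C[n]) := fun y hy => by
  obtain ⟨x, hx, rfl⟩ := surjOn_cube hsurj hy.1
  exact ⟨x, mem_bdry_of_not_mem_openUnitCube hx fun hxo =>
    not_mem_openUnitCube_of_mem_bdry hy (mapsTo_openUnitCube hc hinj (mapsTo_cube hsurj) hxo), rfl⟩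

/-- A continuous injective map of the cube onto itself maps the open cube onto the open cube.
(Tao 2014, Thm. 6.0.12.) [folklore] -/
theorem image_openUnitCube (hc : ContinuousOn Φ (cube n)) (hinj : InjOn Φ (cube n))
    (hsurj : Φ '' cube n = cube n) : Φ '' openUnitCube n = openUnitCube n := by
  refine Subset.antisymm (mapsTo_openUnitCube hc hinj (mapsTo_cube hsurj)).image_subset fun y hy => ?_
  obtain ⟨x, hx, rfl⟩ := surjOn_cube hsurj (openUnitCube_subset_cube hy)
  exact ⟨x, mem_openUnitCube_of_apply_mem hc hinj hsurj hx hy, rfl⟩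

end SelfMap

end Hyperoctahedral

/-- Anchor of this helper file (registered sub-goal `stub_hyperoctahedral_boundary` of crux
stmt-KontsevichZagierPeriods-3929, serving `stub_hyperoctahedralFactorisation` of line
`lin-stokes-sym`): a continuous injective map of the closed cube `[0,1]ⁿ` onto itself maps boundary
points (some coordinate in `{0,1}`) to boundary points (`Hyperoctahedral.mapsTo_bdry`, invariance
of domain). [folklore] -/
theorem stub_hyperoctahedral_boundary : ∀ (n : ℕ) (Φ : (Fin n → ℝ) → (Fin n → ℝ)), ContinuousOn Φ (cube n) → Set.InjOn Φ (cube n) → Φ '' cube n = cube n → ∀ x ∈ cube n, (∃ i, x i = 0 ∨ x i = 1) → ∃ k, Φ x k = 0 ∨ Φ x k = 1 :=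
  fun _ _ hc hinj hsurj _ hx hxb => (Hyperoctahedral.mapsTo_bdry hc hinj hsurj ⟨hx, hxb⟩).2

end Summit.KontsevichZagierPeriods.FurushoPentagon.ReducedPeriodRing.LinStokesSym
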